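import Literature.AlgebraicGeometry.ModuliOfAbelianVarieties.Lan2013.Sec521to523PrincipalLevelData
import Literature.AlgebraicGeometry.ModuliOfAbelianVarieties.Lan2013.Sec131QuasiIsogenies
import Literature.AlgebraicGeometry.AbelianSchemes.AbelianSchemeOverHomNoetherianAnyBase
import Mathlib.AlgebraicGeometry.Morphisms.Separated
import HarnessLib

/-!
# [Lan2013PELCompactifications] §5.2.3 — DISCHARGES for `Sec521to523PrincipalLevelData` (RULING TS-1: proofs live here)

* `Lan2013_52311_sections_determined_holds` — **Cor. 5.2.3.11** (p. 312) DISCHARGED: two sections of an abelian scheme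
  `A → Spec R` (`R` a noetherian normal domain, fraction field `K`) that agree at the generic point `Spec K → Spec R` are
  equal — `Spec K → Spec R` is dominant (injective `R → K`), `A → S` is separated (proper), `Spec R` is reduced; Mathlib
  `AlgebraicGeometry.ext_of_isDominant_of_isSeparated`.
* `LiftingTriple.bPoint_pow_eq_one_of_isCommMonObj` — the computation of **Lem. 5.2.3.12** (p. 312): in the (commutative)
  group `A^∨(T)`, `b_n(y∕n)^n = (c_n^∨(y∕n) ≫ λ_A)^n · (c_n(φ(y)∕n)^n)⁻¹ = (c^∨(y) ≫ λ_A) · c(φ y)⁻¹ = 1` by `c_n|_X = c`,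
  `c_n^∨|_Y = c^∨` (`cn_res`, `cdn_res`), `λ_A` a homomorphism (★ `Polarization.isMonHom`, Mathlib `IsMonHom.monoidHom`)
  and `λ_A c^∨ = c φ` (★ `DDPEData.compat`).
* `LiftingTriple.bPoint_pow_eq_one` — the same UNCONDITIONALLY over a noetherian `R` (★
  `AbelianSchemeOver.isCommMonObj_of_isLocallyNoetherian_base`, [MFK] Cor. 6.5 over a locally noetherian base).
* `Lan2013_52312_bPoint_torsion_of_1317` — the CLOSED fact `Lan2013_52312_bPoint_torsion` quantifies over an ARBITRARY
  base ring `R`; there the commutativity of `A^∨(T)` is exactly the named fact ★ `Sec131QuasiIsogenies.Lan2013_1317_isCommMonObj`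
  (Cor. 1.3.1.7 = [MFK] Cor. 6.5 over any base; the tree proves it over locally noetherian bases only), so the fact is
  discharged MODULO `Lan2013_1317_isCommMonObj` — no other hypothesis.

No new definitions, no new named facts (D-0026: net debt −1).  Squad TS «Lan2013», seat TS-t03 (g0).  HC_CM is proved only
modulo the 7 printed citations until rung 0 closes; this file discharges none of them.

## References
* [Lan2013PELCompactifications] K.-W. Lan, *Arithmetic compactifications of PEL-type Shimura varieties*, LMS Monographs 36,
  Princeton University Press (2013): Cor. 5.2.3.11, Lem. 5.2.3.12 (p. 312); Cor. 1.3.1.7 (p. 60).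
* [MumfordFogartyKirwan1994] D. Mumford, J. Fogarty, F. Kirwan, *Geometric Invariant Theory*, 3rd ed. (1994), Ch. 6 §1
  Cor. 6.5 (p. 117).
-/

universe u

open CategoryTheory CategoryTheory.Limits AlgebraicGeometry MonoidalCategory
open scoped MonObj

namespace Literature.AlgebraicGeometry.ModuliOfAbelianVarieties.Lan2013.Sec521to523PrincipalLevelData

open Literature.AlgebraicGeometry.AbelianSchemes
open Literature.AlgebraicGeometry.ModuliOfAbelianVarieties.Lan2013.Sec51DataWithoutLevel
open Literature.AlgebraicGeometry.ModuliOfAbelianVarieties.Lan2013.Sec131QuasiIsogenies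

/-! ### Cor. 5.2.3.11 -/

/-- `Spec` of an injective ring map is dominant (kernel `0 ≤` nilradical). [folklore] -/
private theorem isDominant_specMap_of_injective {A B : Type u} [CommRing A] [CommRing B] (f : A →+* B)
    (hf : Function.Injective f) : IsDominant (Spec.map (CommRingCat.ofHom f)) := by
  constructor
  change DenseRange (PrimeSpectrum.comap f)
  rw [PrimeSpectrum.denseRange_comap_iff_ker_le_nilRadical, (RingHom.injective_iff_ker_eq_bot f).mp hf]
  exact bot_le

/-- **Corollary 5.2.3.11** DISCHARGED: sections of an abelian scheme over a noetherian normal domain agreeing at the generic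
point are equal. [cite: Lan2013PELCompactifications, Cor. 5.2.3.11 (p. 312)] -/
theorem Lan2013_52311_sections_determined_holds : Lan2013_52311_sections_determined := by
  intro R _ _ _ _ K _ _ _ A s s' h
  haveI := A.isProper
  -- the dominance instance at the syntactic codomain `(𝟙_ (Over S)).left` (= `S` by `rfl`) of `s.left`
  haveI : @IsDominant (Spec (.of K)) (𝟙_ (Over (Spec (.of R)))).left
      (Spec.map (CommRingCat.ofHom (algebraMap R K))) :=
    isDominant_specMap_of_injective (algebraMap R K) (IsFractionRing.injective R K)
  haveI : IsReduced (𝟙_ (Over (Spec (.of R)))).left := (inferInstance : IsReduced (Spec (.of R)))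
  apply Over.OverMorphism.ext
  have hl := congrArg CommaMorphism.left h
  simp only [Over.comp_left, Over.toUnit_left, Over.mk_hom] at hl
  exact ext_of_isDominant_of_isSeparated A.X.hom (by rw [Over.w, Over.w])
    (Spec.map (CommRingCat.ofHom (algebraMap R K))) hl

/-! ### Lem. 5.2.3.12: `b_n(y∕n)` is `n`-torsion -/

section Torsion

variable {R : Type} [CommRing R] {I : Ideal R} {K : Type} [Field K] [Algebra R K] {O : Type} [CommRing O] [StarRing O]
  {X Y : Type} [AddCommGroup X] [Module O X] [AddCommGroup Y] [Module O Y]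
  {𝔇 : DDPEData R I K O X Y} {n : ℕ} {T : Over (Spec (.of R))}

/-- **Lemma 5.2.3.12**, the computation, for a commutative `A^∨`: `b_n(y∕n)^n = 1`.
[cite: Lan2013PELCompactifications, Lem. 5.2.3.12 (p. 312)] -/
theorem LiftingTriple.bPoint_pow_eq_one_of_isCommMonObj [IsCommMonObj 𝔇.D.hat.X] (𝔱 : LiftingTriple 𝔇 n T) (y : Y) :
    𝔱.bPoint y ^ n = 1 := by
  haveI := 𝔇.pol.isMonHom
  have ha : (𝔱.cdn (Multiplicative.ofAdd y) ≫ 𝔇.pol.lam) ^ n =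
      CartesianMonoidalCategory.toUnit T ≫ 𝔇.c (Multiplicative.ofAdd (𝔇.φ y)) := by
    have h1 : (𝔱.cdn (Multiplicative.ofAdd y) ≫ 𝔇.pol.lam) ^ n = (𝔱.cdn (Multiplicative.ofAdd y) ^ n) ≫ 𝔇.pol.lam := by
      simpa only [IsMonHom.monoidHom_apply] using
        (map_pow (IsMonHom.monoidHom 𝔇.pol.lam T) (𝔱.cdn (Multiplicative.ofAdd y)) n).symm
    rw [h1, ← map_pow, ← ofAdd_nsmul, 𝔱.cdn_res, Category.assoc, 𝔇.compat]
  have hb : 𝔱.cn (Multiplicative.ofAdd (𝔇.φ y)) ^ n =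
      CartesianMonoidalCategory.toUnit T ≫ 𝔇.c (Multiplicative.ofAdd (𝔇.φ y)) := by
    rw [← map_pow, ← ofAdd_nsmul, 𝔱.cn_res]
  have hc : Commute (𝔱.cdn (Multiplicative.ofAdd y) ≫ 𝔇.pol.lam) (𝔱.cn (Multiplicative.ofAdd (𝔇.φ y)))⁻¹ :=
    mul_comm _ _
  show ((𝔱.cdn (Multiplicative.ofAdd y) ≫ 𝔇.pol.lam) * (𝔱.cn (Multiplicative.ofAdd (𝔇.φ y)))⁻¹) ^ n = 1
  rw [hc.mul_pow, inv_pow, ha, hb, mul_inv_cancel]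

/-- **Lemma 5.2.3.12** UNCONDITIONALLY over a noetherian base ring `R`: `b_n(y∕n)^n = 1` ([MFK] Cor. 6.5 over a locally
noetherian base, ★ `isCommMonObj_of_isLocallyNoetherian_base`). [cite: Lan2013PELCompactifications, Lem. 5.2.3.12 (p. 312)]
[cite: MumfordFogartyKirwan1994, Ch. 6 §1 Corollary 6.5 (p. 117)] -/
theorem LiftingTriple.bPoint_pow_eq_one [IsNoetherianRing R] (𝔱 : LiftingTriple 𝔇 n T) (y : Y) : 𝔱.bPoint y ^ n = 1 := by
  haveI := 𝔇.D.hat.isCommMonObj_of_isLocallyNoetherian_base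
  exact 𝔱.bPoint_pow_eq_one_of_isCommMonObj y

end Torsion

/-- **Lemma 5.2.3.12** over an ARBITRARY base, MODULO Cor. 1.3.1.7 (★ `Lan2013_1317_isCommMonObj`: abelian schemes over any
base are commutative). [cite: Lan2013PELCompactifications, Lem. 5.2.3.12 (p. 312) and Cor. 1.3.1.7 (p. 60)] -/
theorem Lan2013_52312_bPoint_torsion_of_1317 (h : Lan2013_1317_isCommMonObj) : Lan2013_52312_bPoint_torsion := by
  intro R _ I K _ _ O _ _ X Y _ _ _ _ 𝔇 n T 𝔱 y
  haveI := h _ 𝔇.D.hat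
  exact 𝔱.bPoint_pow_eq_one_of_isCommMonObj y

end Literature.AlgebraicGeometry.ModuliOfAbelianVarieties.Lan2013.Sec521to523PrincipalLevelData
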